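import Summits.BirchSwinnertonDyer.Rank1Residual.Additive.LocalSubgroupTransport
import Literature.NumberTheory.GaloisRepresentations.LocalGaloisGroup
import HarnessLib

/-!
# LP-B shell: an isomorphism of algebraic closures compatible with an integral embedding of local
# fields carries inertia to inertia (cell `b2b-bsdres`, unit `b2b-bsdres-eisenstein-p1`, gen 19;
# X1R0-GAPMAP §28.4 (LP-B), memo `V76-LOCAL-TERM-PLAN.md` §5.3–5.5)

HONEST FRAMING (run/shared/lean/b2b/bsd-rank1-residual/, verbatim in every file): the goal of the
cell is to DELETE the COMBINATION-SHAPED residual classes of the Birch–Swinnerton-Dyer formula for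
ALL analytic-rank `≤ 1` elliptic curves over `ℚ` — "full BSD formula for every rank `≤ 1` curve in
class `C`" assembled STRICTLY from published theorems — so that the rank-`≤ 1` remainder becomes
exactly the CONSTRUCTION-SHAPED classes, which are TYPED (missing-input `Prop`s), NOT attempted.
This is not "finishing BSD". Sub-cell `b2b-bsdres-eisenstein-p1`: research route; NO CLAIM BEYOND
STATED CLASSES; nothing here changes a label; nothing is booked. THEOREMS ONLY — no definition, no
named fact; pure local-field / Galois plumbing, nothing about any curve.

## What and why

The local package at the prime `wp` of `ℚ_n` above `p` (what is left of the local term `a` after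
`X1/GeneratorCountLayerAtPStrict`) needs the INERTIA BRIDGE (memo §5.3): n1011's transport
`θ = ι₂ (·) ι₂⁻¹ : Γ_{K_v} ⊇ H_ι → Γ_{L_w}` (`Additive/LocalSubgroupTransport.transportAut/transportHom`,
for the factorisation isomorphism `ι₂ : \bar K_v ≃ \bar L_w`) must carry the inertia group
`absInertia K_v` into `absInertia L_w`. Both inertia groups are ALGEBRAIC
(`absInertia F = (absMaximalIdeal F).inertia Γ_F`, `absIntegers 𝒪[F] F = integralClosure`,
`absMaximalIdeal F = rad(𝓂[F]·S)`), so the bridge reduces to three transport facts for `ι₂`. This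
file proves the SHELL: for local fields `E → E'` (`f`, with `g : 𝒪[E] → 𝒪[E']` over it sending
`𝓂[E]` into `𝓂[E']`) and `ι₂ : Ē ≃+* Ē'` over `f`:

* `ringEquiv_mem_absIntegers` — (a) `ι₂(S_E) ⊆ S_{E'}` (`IsIntegral.map_of_comp_eq`);
* `ringEquiv_mem_absMaximalIdeal` — (c) `ι₂(𝔓_E) ⊆ 𝔓_{E'}`;
* `transportAut_mem_absInertia` — GIVEN (b) `ι₂⁻¹(S_{E'}) ⊆ S_E` (the one genuinely arithmetic
  input: `𝒪_{L_w}` is integral over `𝒪_{K_v}`; memo §5.5), `h ∈ absInertia E` implies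
  `ι₂ h ι₂⁻¹ ∈ absInertia E'`.

References: [SerreLocalFields1979] Ch. I §7, Ch. II §2 Prop. 3; [SerreGaloisCohomology1997]
II.§1.1; [NeukirchANT1999] Ch. II (4.8), (6.2).
-/

noncomputable section

open scoped Pointwise Valued
open ValuativeRel Field Literature.NumberTheory.GaloisRepresentations
  Literature.NumberTheory.GaloisRepresentations.IsNonarchimedeanLocalField
  Summit.BirchSwinnertonDyer.Rank1Residual.Additive.LocalTransport

universe u

namespace Summit.BirchSwinnertonDyer.Rank1Residual.X1.InertiaTransport

variable {E : Type u} [Field E] [ValuativeRel E] {E' : Type u} [Field E'] [ValuativeRel E']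
variable (f : E →+* E') (g : 𝒪[E] →+* 𝒪[E'])
  (hg : ∀ a : 𝒪[E], ((g a : 𝒪[E']) : E') = f (a : E))
  (ι₂ : AlgebraicClosure E ≃+* AlgebraicClosure E')
  (hι₂ : ∀ x : E, ι₂ (algebraMap E (AlgebraicClosure E) x) =
    algebraMap E' (AlgebraicClosure E') (f x))

include hg hι₂ in
/-- The square `𝒪[E] → Ē →ι₂ Ē'` = `𝒪[E] →g 𝒪[E'] → Ē'` commutes. [folklore] -/
theorem algebraMap_comp_eq :
    (algebraMap 𝒪[E'] (AlgebraicClosure E')).comp g =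
      ι₂.toRingHom.comp (algebraMap 𝒪[E] (AlgebraicClosure E)) := by
  ext a
  change algebraMap 𝒪[E'] (AlgebraicClosure E') (g a) = ι₂ (algebraMap 𝒪[E] (AlgebraicClosure E) a)
  rw [IsScalarTower.algebraMap_apply 𝒪[E'] E' (AlgebraicClosure E'),
    IsScalarTower.algebraMap_apply 𝒪[E] E (AlgebraicClosure E), hι₂]
  exact congrArg _ (hg a)

include hg hι₂ in
/-- **(a) `ι₂` maps the absolute integers of `E` into those of `E'`** (an integral equation over
`𝒪[E]` is pushed along `g`). [cite: NeukirchANT1999, Ch. II (6.2)] -/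
theorem ringEquiv_mem_absIntegers {x : AlgebraicClosure E} (hx : x ∈ absIntegers 𝒪[E] E) :
    ι₂ x ∈ absIntegers 𝒪[E'] E' := by
  have hx' : IsIntegral 𝒪[E] x := hx
  exact hx'.map_of_comp_eq g ι₂.toRingHom (algebraMap_comp_eq f g hg ι₂ hι₂)

include hg hι₂ in
/-- The restriction `S_E →+* S_{E'}` of `ι₂` to the absolute integers. [folklore] -/
theorem exists_ringHom_absIntegers :
    ∃ ψ : absIntegers 𝒪[E] E →+* absIntegers 𝒪[E'] E',
      (∀ z, ((ψ z : absIntegers 𝒪[E'] E') : AlgebraicClosure E') = ι₂ z) ∧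
      ψ.comp (algebraMap 𝒪[E] (absIntegers 𝒪[E] E)) =
        (algebraMap 𝒪[E'] (absIntegers 𝒪[E'] E')).comp g := by
  refine ⟨{ toFun := fun z ↦ ⟨ι₂ z, ringEquiv_mem_absIntegers f g hg ι₂ hι₂ z.2⟩
            map_one' := Subtype.ext (by simp)
            map_mul' := fun a b ↦ Subtype.ext (by simp)
            map_zero' := Subtype.ext (by simp)
            map_add' := fun a b ↦ Subtype.ext (by simp) }, fun _ ↦ rfl, ?_⟩
  ext a
  change ι₂ ((algebraMap 𝒪[E] (absIntegers 𝒪[E] E) a : absIntegers 𝒪[E] E) : AlgebraicClosure E) =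
    ((algebraMap 𝒪[E'] (absIntegers 𝒪[E'] E') (g a) : absIntegers 𝒪[E'] E') : AlgebraicClosure E')
  have h1 : ((algebraMap 𝒪[E] (absIntegers 𝒪[E] E) a : absIntegers 𝒪[E] E) : AlgebraicClosure E) =
      algebraMap 𝒪[E] (AlgebraicClosure E) a := rfl
  have h2 : ((algebraMap 𝒪[E'] (absIntegers 𝒪[E'] E') (g a) : absIntegers 𝒪[E'] E') :
      AlgebraicClosure E') = algebraMap 𝒪[E'] (AlgebraicClosure E') (g a) := rfl
  rw [h1, h2]
  exact (RingHom.congr_fun (algebraMap_comp_eq f g hg ι₂ hι₂) a).symm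

section Local

variable [TopologicalSpace E] [IsNonarchimedeanLocalField E] [TopologicalSpace E']
  [IsNonarchimedeanLocalField E']

include hg hι₂ in
/-- **(c) `ι₂` maps the canonical prime `𝔓_E = rad(𝓂[E]·S_E)` into `𝔓_{E'}`**, provided `g` maps
`𝓂[E]` into `𝓂[E']`. [cite: SerreLocalFields1979, Ch. II §2 Prop. 3] -/
theorem ringEquiv_mem_absMaximalIdeal (hg𝓂 : ∀ a ∈ 𝓂[E], g a ∈ 𝓂[E'])
    (z : absIntegers 𝒪[E] E) (hz : z ∈ absMaximalIdeal E) :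
    (⟨ι₂ z, ringEquiv_mem_absIntegers f g hg ι₂ hι₂ z.2⟩ : absIntegers 𝒪[E'] E') ∈
      absMaximalIdeal E' := by
  obtain ⟨ψ, hψ, hψcomp⟩ := exists_ringHom_absIntegers f g hg ι₂ hι₂
  have hψz : (⟨ι₂ z, ringEquiv_mem_absIntegers f g hg ι₂ hι₂ z.2⟩ : absIntegers 𝒪[E'] E') = ψ z :=
    Subtype.ext (hψ z).symm
  rw [hψz]
  -- `ψ` maps `𝓂[E]·S_E` into `𝓂[E']·S_{E'}`
  have hmap : (Ideal.map (algebraMap 𝒪[E] (absIntegers 𝒪[E] E)) 𝓂[E]).map ψ ≤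
      Ideal.map (algebraMap 𝒪[E'] (absIntegers 𝒪[E'] E')) 𝓂[E'] := by
    rw [Ideal.map_map, hψcomp, ← Ideal.map_map]
    exact Ideal.map_mono (Ideal.map_le_iff_le_comap.mpr fun a ha ↦ hg𝓂 a ha)
  change ψ z ∈ (Ideal.map (algebraMap 𝒪[E'] (absIntegers 𝒪[E'] E')) 𝓂[E']).radical
  obtain ⟨n, hn⟩ := (Ideal.mem_radical_iff.mp hz : ∃ n, z ^ n ∈ _)
  refine Ideal.mem_radical_iff.mpr ⟨n, ?_⟩
  rw [← map_pow]
  exact hmap (Ideal.mem_map_of_mem ψ hn)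

include hg hι₂ in
/-- **THE SHELL OF THE INERTIA BRIDGE.** If moreover (b) `ι₂⁻¹` maps the absolute integers of `E'`
into those of `E` (i.e. `𝒪[E']` is integral over `g(𝒪[E])` — the arithmetic input, memo §5.5), then
for every `h ∈ absInertia E` fixing `ι₂⁻¹(E')` the transported automorphism
`transportAut ι₂ h = ι₂ h ι₂⁻¹ ∈ Γ_{E'}` lies in `absInertia E'`:
`ι₂hι₂⁻¹(y) − y = ι₂(h x − x)` with `x = ι₂⁻¹ y ∈ S_E` and `h x − x ∈ 𝔓_E`.
[cite: SerreLocalFields1979, Ch. I §7, Ch. II §2 Prop. 3] [cite: SerreGaloisCohomology1997, II.§1.1] -/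
theorem transportAut_mem_absInertia (hg𝓂 : ∀ a ∈ 𝓂[E], g a ∈ 𝓂[E'])
    (hb : ∀ y : AlgebraicClosure E', y ∈ absIntegers 𝒪[E'] E' → ι₂.symm y ∈ absIntegers 𝒪[E] E)
    (h : absoluteGaloisGroup E)
    (hh : ∀ y : E', (show AlgebraicClosure E ≃ₐ[E] AlgebraicClosure E from h)
      (ι₂.symm (algebraMap E' (AlgebraicClosure E') y)) =
        ι₂.symm (algebraMap E' (AlgebraicClosure E') y))
    (hI : h ∈ absInertia E) : transportAut ι₂ h hh ∈ absInertia E' := by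
  rw [mem_absInertia_iff] at hI ⊢
  intro y
  set x : absIntegers 𝒪[E] E := ⟨ι₂.symm y, hb y y.2⟩ with hx
  have h1 := ringEquiv_mem_absMaximalIdeal f g hg ι₂ hι₂ hg𝓂 (h • x - x) (hI x)
  convert h1 using 1
  apply Subtype.ext
  change (show AlgebraicClosure E' ≃ₐ[E'] AlgebraicClosure E' from transportAut ι₂ h hh) y - y =
    ι₂ ((h • x - x : absIntegers 𝒪[E] E) : AlgebraicClosure E)
  rw [AddSubgroupClass.coe_sub, integralClosure.coe_smul, map_sub, transportAut_apply]
  change _ = ι₂ ((show AlgebraicClosure E ≃ₐ[E] AlgebraicClosure E from h) (ι₂.symm y)) -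
    ι₂ (ι₂.symm y)
  rw [RingEquiv.apply_symm_apply]

end Local

end Summit.BirchSwinnertonDyer.Rank1Residual.X1.InertiaTransport

end
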